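import Literature.AlgebraicGeometry.Shioda1982.ExceptionalQuadruplesComplete
import HarnessLib

/-!
# Shioda 1982 / Meyer–Neutsch 1981: no exceptional quadruple at the level `N = 210` (kernel sweep above Aoki's bound `180`)

Topic `Literature/AlgebraicGeometry/Shioda1982`; companion of `ExceptionalQuadruplesComplete.lean` (search `checkB`, soundness
`tabelleOneCompleteAt_of_chunks`, invariant form `exists_mem_reps_of_isExceptionalQuadruple`, statement `TabelleOneCompleteAt`; sources,
method and framing in its module docstring) and of the series `ExceptionalQuadruplesSweep*.lean` (together: every level `2 ≤ N ≤ 180`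
that is not a row of Tabelle 1, and above `180` the levels `198, 200, 220, 234, 252, 260, 264, 280, 312, 340, 396, 440, 468, 520`).
THEOREMS only (no definition, no named fact): the same kernel search at the single level `N = 210 = 2·3·5·7`,
which carries NO row of [MeyerNeutsch1981Fermatquadrupel, Tabelle 1] (computer-generated there, "alle Fermatquadrupel für N ≤ 614
ermittelt", §2 p. 53) and lies above the range `N ≤ 180` of Shioda's table p. 727 — by Aoki's Theorem C ([Aoki1983], computer-assisted
for `181 ≤ m ≤ 672`) there is no exceptional element at any level `> 180`; this file makes the instance `N = 210` a kernel statement: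
`completeAt_twoHundredTen` (every sorted pair-free primitive Hodge 4-multiset mod `210` is standard) and `not_isExceptionalQuadruple_twoHundredTen`.
WHY THIS LEVEL (cell `pub-hfermat`): `210 = 2·3·5·7` is squarefree with no prime factor `≥ 11`: it is not an instance of any of the tree's character-sum
families (`PicardNumber<K>Prime.lean`, `…TwoPowerPrime`, `…ThreePowPrime`: a constant or a prime power times a prime `p ≥ 11`),
nor of those needing a square divisor `p²` (`p ≥ 5`) of the level.
`decide +kernel` only (no `native_decide`), chunked by first entries to bound the memory of
a single kernel evaluation (14 chunks; this file visits 262780 candidate triples, `φ(210) − 1 = 47` units each).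

HONEST FRAMING (cell `pub-hfermat`): explicit algebraic cycles for specific Hodge classes on Fermat/Delsarte varieties; residual open
instances listed; no claim on general Hodge. These classes are algebraic (Lefschetz (1,1)); certified here is only the emptiness of the
exceptional list at this level.

## References
* [MeyerNeutsch1981Fermatquadrupel] W. Meyer, W. Neutsch, *Fermatquadrupel*, Math. Ann. 256 (1981) 51–62, §2 p. 53, Tabelle 1 p. 54 (no row 210).
* [Shioda1982PicardFermat] T. Shioda, J. Fac. Sci. Univ. Tokyo IA 28 (1982) 725–734, table p. 727 (levels `≤ 180`), Prop. 4 (Q′) p. 729.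
* [Aoki1983] N. Aoki, Math. Ann. 266 (1983) 23–54, Thm. C.
-/

namespace Literature.AlgebraicGeometry.Shioda1982

open Literature.AlgebraicGeometry.HodgeTheory

set_option maxHeartbeats 0 in
/-- **Tabelle 1 is complete at `N = 210`, where it is empty**: every sorted Hodge 4-multiset mod `210` without a pair and with
`gcd = 1` is standard. Kernel exhaustion (`checkB`, 14 chunks of first entries, 262780 candidate triples).
[cite: MeyerNeutsch1981Fermatquadrupel, §2 p. 53 ("alle Fermatquadrupel für N ≤ 614 ermittelt") and Tabelle 1 p. 54 (no row 210)]
[cite: Aoki1983, Thm. C] [cite: Shioda1982PicardFermat, Prop. 4 (Q′) p. 729] -/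
theorem completeAt_twoHundredTen : TabelleOneCompleteAt 210 :=
  tabelleOneCompleteAt_of_chunks 210 [(0, 5), (5, 5), (10, 5), (15, 5), (20, 5), (25, 5), (30, 5), (35, 5), (40, 6), (46, 6), (52, 7), (59, 9), (68, 19), (87, 123)] (by decide +kernel) (by
    intro p hp
    simp only [List.mem_cons, List.not_mem_nil, or_false] at hp
    rcases hp with rfl | rfl | rfl | rfl | rfl | rfl | rfl | rfl | rfl | rfl | rfl | rfl | rfl | rfl <;> decide +kernel)

/-- **No exceptional quadruple ("Ausnahmequadrupel") at the level `210`** (`tabelleOne 210 = []`).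
[cite: MeyerNeutsch1981Fermatquadrupel, Tabelle 1 p. 54 (no row 210)] [cite: Aoki1983, Thm. C] -/
theorem not_isExceptionalQuadruple_twoHundredTen (s : Multiset (ZMod 210)) : ¬ IsExceptionalQuadruple 210 s := by
  intro hs
  obtain ⟨r, hr, -⟩ := exists_mem_reps_of_isExceptionalQuadruple completeAt_twoHundredTen hs
  simp [reps, tabelleOne] at hr

end Literature.AlgebraicGeometry.Shioda1982
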